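import Summits.QuantumFields.YangMills.Theorems.FlatTubeReductionPinnedUnitStepExDefs
import Summits.QuantumFields.YangMills.Theorems.FlatTubeReductionUnitLadder
import Summits.QuantumFields.YangMills.Theorems.FemtoTransferGapMomentConvexity
import HarnessLib

/-!
# Route `FlatTubeReduction`, crux `PinnedUnitStepEx` (stmt-QuantumFields-27561) — THE ONE-STEP DOOR of stub 2 (`stub_pinnedAutocorrExTI1`)

Seat ym-line-fcl-p3 g10 (2026-08-28).  Registered skeleton «ti-split-1» v2 (planner ym-idea-1 g6; stub Props in
`Theorems/FlatTubeReductionPinnedUnitStepExDefs.lean`, p633258; stub 1 `stub_smearVarPosGS1` LANDED p642758).  The remaining stub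
`PinnedAutocorrExTI1` asks, for a translation-invariant pinned coarse excitation `φ′` and its one-slab smeared trial `ψ = fbar·Ω`, the
`(L′+1)`-STEP autocorrelation comparison

  `λ₁′^{L′}·λ₀^{L′+1}·V ≤ e^{CΛ²/L′}·λ₀′^{L′}·R_{L′+1}`,  `V = ‖ψ‖² − ⟨ψ,Ω⟩²`, `R_n = ⟨ψ,K_β^nψ⟩ − λ₀^n⟨ψ,Ω⟩²`.

This file proves that the ONE-STEP (Rayleigh-quotient) comparison

  `λ₁′^{L′}·λ₀^{L′+1}·V^{L′+1} ≤ e^{CΛ²/L′}·λ₀′^{L′}·R₁^{L′+1}`  (energy reading: `z_trial := −(L′+1)·log(R₁/(λ₀V)) ≤ z′ + CΛ²/L′`)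

IMPLIES the registered form with the same constants and the same `φ′` (`pinnedAutocorrExTI1_of_oneStep`), through the abstract fixed-lattice
lemma `UpStep.multiStep_of_oneStep`: the vacuum-recentred vector `v = ψ − ⟨ψ,Ω⟩Ω` has `V = ‖v‖²`, `R_n = ⟨v,K^n v⟩` (`UpStep.recentred_moments`),
and the transfer moments of a physical `v` are log-convex (`FemtoTransferGap.moment_one_pow_le`: `R₁^{n+1} ≤ V^n R_{n+1}`, Jensen without the
spectral theorem).  So the registered autocorrelation form is the WEAKER (more UV-robust) of the two natural forms of the pinned comparison; a
supplier proving the one-step bound closes the stub through this door.  HONEST FRAMING: a door only — the two-cutoff analytic content of the stub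
(XL, class `Literature.Barriers.QuantumFields.UVStabilityNonUniqueness`) is untouched; R2b1 is a RECORD rung; no stub, crux or summit is proved.
References: M. Reed, B. Simon IV (1978) Thm XIII.1; M. Lüscher, NPB 219 (1983) §3.
-/

set_option autoImplicit false

noncomputable section

namespace Summit.QuantumFields.YangMills.Theorems.FemtoTransferGap.UpStep

open MeasureTheory
open Literature.MathematicalPhysics.QuantumFieldTheory
open Summit.QuantumFields.YangMills.Theorems.FemtoTransferGap

variable {L : ℕ} [NeZero L]

/-- **Multi-step from one-step (cross-multiplied form).**  For a physical normalised exact ground state `Ω` of `K_β` (`β ≥ 0`), a physical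
`w`, constants `a ∈ ℝ`, `b, e ≥ 0` and `n : ℕ`: if the ONE-STEP inequality `a · V^{n+1} ≤ e · b · R₁^{n+1}` holds for the vacuum-recentred
variance `V = ‖w‖² − ⟨w,Ω⟩²` and one-step form `R₁ = ⟨w,K_βw⟩ − λ₀⟨w,Ω⟩²`, then the `(n+1)`-STEP inequality `a · V ≤ e · b · R_{n+1}`,
`R_{n+1} = ⟨w,K_β^{n+1}w⟩ − λ₀^{n+1}⟨w,Ω⟩²`, holds — by log-convexity of the moments of `v = w − ⟨w,Ω⟩Ω` (`moment_one_pow_le`: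
`R₁^{n+1} ≤ V^n R_{n+1}`) and `R_{n+1} ≥ 0`. [cite: ReedSimonIV1978, Thm. XIII.1] -/
theorem multiStep_of_oneStep {β : ℝ} (hβ : 0 ≤ β) {Ω w : GaugeConfig 3 L SU2 → ℝ} (hΩ : IsPhys Ω) (hΩ1 : l2 Ω Ω = 1)
    (hΩeig : transferApply β Ω = topValue su2Rep L β • Ω) (hw : IsPhys w) {a b e : ℝ} (hb : 0 ≤ b) (he : 0 ≤ e) (n : ℕ)
    (h1 : a * (l2 w w - l2 w Ω ^ 2) ^ (n + 1) ≤
      e * (b * (l2 w (transferApply β w) - topValue su2Rep L β * l2 w Ω ^ 2) ^ (n + 1))) :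
    a * (l2 w w - l2 w Ω ^ 2) ≤
      e * (b * (l2 w ((transferApply β)^[n + 1] w) - topValue su2Rep L β ^ (n + 1) * l2 w Ω ^ 2)) := by
  obtain ⟨hv, -, hnorm, htwo⟩ := recentred_moments β hΩ hΩ1 hΩeig hw (n + 1)
  obtain ⟨-, -, -, hone⟩ := recentred_moments β hΩ hΩ1 hΩeig hw 1
  set v : GaugeConfig 3 L SU2 → ℝ := w + (-(l2 w Ω)) • Ω with hvdef
  rw [Function.iterate_one, pow_one] at hone
  -- the one-step and multi-step quantities as moments of `v`
  set V : ℝ := l2 w w - l2 w Ω ^ 2 with hV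
  set R1 : ℝ := l2 w (transferApply β w) - topValue su2Rep L β * l2 w Ω ^ 2 with hR1
  set Rn : ℝ := l2 w ((transferApply β)^[n + 1] w) - topValue su2Rep L β ^ (n + 1) * l2 w Ω ^ 2 with hRn
  have hVeq : l2 v v = V := hnorm
  have hR1eq : l2 v (transferApply β v) = R1 := hone
  have hRneq : l2 v ((transferApply β)^[n + 1] v) = Rn := htwo
  have hV0 : 0 ≤ V := by rw [← hVeq]; exact l2_self_nonneg _
  have hRn0 : 0 ≤ Rn := by rw [← hRneq]; exact moment_nonneg hβ hv (n + 1)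
  have hmom : R1 ^ (n + 1) ≤ V ^ n * Rn := by
    rw [← hVeq, ← hR1eq, ← hRneq]; exact moment_one_pow_le hβ hv n
  rcases hV0.lt_or_eq with hVpos | hVzero
  · -- divide the chain `a V^{n+1} ≤ e b R₁^{n+1} ≤ e b V^n R_{n+1}` by `V^n > 0`
    have hVn : 0 < V ^ n := pow_pos hVpos n
    have hchain : (a * V) * V ^ n ≤ (e * (b * Rn)) * V ^ n :=
      calc (a * V) * V ^ n = a * V ^ (n + 1) := by ring
        _ ≤ e * (b * R1 ^ (n + 1)) := h1
        _ ≤ e * (b * (V ^ n * Rn)) := mul_le_mul_of_nonneg_left (mul_le_mul_of_nonneg_left hmom hb) he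
        _ = (e * (b * Rn)) * V ^ n := by ring
    exact le_of_mul_le_mul_right hchain hVn
  · rw [← hVzero, mul_zero]
    exact mul_nonneg he (mul_nonneg hb hRn0)

end Summit.QuantumFields.YangMills.Theorems.FemtoTransferGap.UpStep

namespace Summit.QuantumFields.YangMills.Cruxes.PinnedUnitStepEx.TISplit1

open MeasureTheory
open Literature.MathematicalPhysics.QuantumFieldTheory (Site Edge GaugeConfig gaugeTransform)
open Literature.MathematicalPhysics.QuantumFieldTheory.TorusTranslation
open Summit.QuantumFields.YangMills.Theorems.FemtoTransferGap
open Summit.QuantumFields.YangMills.Theorems.FemtoCutoffLadder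
open Summit.QuantumFields.YangMills.Theorems.FemtoCutoffLadder.Thinning (thin)
open Summit.QuantumFields.YangMills.Theorems.FlatTubeReduction

/-- ★★ **THE ONE-STEP DOOR of stub 2** (`stub_pinnedAutocorrExTI1`).  If, along the femto window and for the item's data `Ω, Ω′`, there is a
translation-invariant normalised coarse `secondValue′`-eigenfunction `φ′ ⊥ Ω′` whose one-slab smeared trial `ψ = fbar·Ω` satisfies the
ONE-STEP (Rayleigh) comparison `λ₁′^{L′}·λ₀^{L′+1}·V^{L′+1} ≤ e^{CΛ²/L′}·λ₀′^{L′}·R₁^{L′+1}` (`V = ‖ψ‖² − ⟨ψ,Ω⟩²`,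
`R₁ = ⟨ψ,K_βψ⟩ − λ₀⟨ψ,Ω⟩²`; in energy language `z_trial := −(L′+1)·log(R₁/(λ₀V)) ≤ z′ + CΛ²/L′`), then the REGISTERED `(L′+1)`-step
autocorrelation form `PinnedAutocorrExTI1` holds with the same `C, lam0, L0, φ′` (`UpStep.multiStep_of_oneStep`).  The registered form is thus
the WEAKER of the two (Jensen); nothing here proves either. [cite: ReedSimonIV1978, Thm. XIII.1] [cite: Luscher1983, §3] -/
theorem pinnedAutocorrExTI1_of_oneStep
    (h : ∃ C lam0 : ℝ, 0 < lam0 ∧ ∀ lam : ℝ, 0 < lam → lam ≤ lam0 → ∃ L0 : ℕ, ∀ (L' : ℕ) [NeZero L'], L0 ≤ L' → ∀ β β' : ℝ,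
      InFemtoWindow lam β (L' + 1) → InFemtoWindow lam β' L' → luscherLambda β (L' + 1) = luscherLambda β' L' →
      ∀ Ω : GaugeConfig 3 (L' + 1) SU2 → ℝ, IsPhys Ω → (∀ U, 0 < Ω U) → l2 Ω Ω = 1 →
      (∀ U, ∫ V, transferKernel su2Rep β U V * Ω V ∂(configMeasure SU2 (L' + 1)) = topValue su2Rep (L' + 1) β * Ω U) →
      ∀ Ω' : GaugeConfig 3 L' SU2 → ℝ, IsPhys Ω' → ∀ c' : ℝ, 0 < c' → (∀ U', c' ≤ Ω' U') → l2 Ω' Ω' = 1 →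
      (∀ U', ∫ V', transferKernel su2Rep β' U' V' * Ω' V' ∂(configMeasure SU2 L') = topValue su2Rep L' β' * Ω' U') →
      ∃ φ' : GaugeConfig 3 L' SU2 → ℝ, IsPhys φ' ∧
        (∀ (v' : Site 3 L') (U' : GaugeConfig 3 L' SU2), φ' (fun e => U' (e.1 - v', e.2)) = φ' U') ∧
        l2 φ' Ω' = 0 ∧ l2 φ' φ' = 1 ∧
        (∀ U', ∫ V', transferKernel su2Rep β' U' V' * φ' V' ∂(configMeasure SU2 L') = secondValue su2Rep L' β' * φ' U') ∧
        let T : GaugeConfig 3 (L' + 1) SU2 → GaugeConfig 3 L' SU2 := fun U e' =>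
          (List.ofFn fun t : Fin (if (e'.1 e'.2).val < L' + 1 - L' then 2 else 1) =>
            U ((fun j => (((e'.1 j).val + min (e'.1 j).val (L' + 1 - L') : ℕ) : ZMod (L' + 1))) +
              Pi.single e'.2 ((t : ℕ) : ZMod (L' + 1)), e'.2)).prod
        let fbar : GaugeConfig 3 (L' + 1) SU2 → ℝ := fun U =>
          (Fintype.card (Site 3 (L' + 1)) : ℝ)⁻¹ *
            ∑ v : Site 3 (L' + 1), φ' (T fun e => U (e.1 - v, e.2)) / Ω' (T fun e => U (e.1 - v, e.2))
        let ψ : GaugeConfig 3 (L' + 1) SU2 → ℝ := fun U => fbar U * Ω U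
        let K : (GaugeConfig 3 (L' + 1) SU2 → ℝ) → (GaugeConfig 3 (L' + 1) SU2 → ℝ) := fun χ U =>
          ∫ V, transferKernel su2Rep β U V * χ V ∂(configMeasure SU2 (L' + 1))
        secondValue su2Rep L' β' ^ L' * topValue su2Rep (L' + 1) β ^ (L' + 1) * (l2 ψ ψ - l2 ψ Ω ^ 2) ^ (L' + 1) ≤
          Real.exp (C * luscherLambda β (L' + 1) ^ 2 / (L' : ℝ)) *
            (topValue su2Rep L' β' ^ L' * (l2 ψ (K ψ) - topValue su2Rep (L' + 1) β * l2 ψ Ω ^ 2) ^ (L' + 1))) :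
    PinnedAutocorrExTI1 := by
  obtain ⟨C, lam0, hlam0, H⟩ := h
  refine ⟨C, lam0, hlam0, fun lam hl hle => ?_⟩
  obtain ⟨L0, H'⟩ := H lam hl hle
  refine ⟨L0, ?_⟩
  intro L' _ hL0 β β' hw hw' hΛ Ω hΩ hpos hn hE Ω' hΩ' c' hc' hlow hn' hE'
  obtain ⟨φ', hφ', hTI, horth, hn1, hE1, hB⟩ := H' L' hL0 β β' hw hw' hΛ Ω hΩ hpos hn hE Ω' hΩ' c' hc' hlow hn' hE'
  refine ⟨φ', hφ', hTI, horth, hn1, hE1, ?_⟩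
  simp only [] at hB ⊢
  -- the trial `ψ = fbar·Ω` is physical
  have hLL : L' ≤ L' + 1 := Nat.le_succ _
  have h2 : L' + 1 ≤ 2 * L' := by have := NeZero.one_le (n := L'); omega
  have hβ0 : 0 ≤ β := zero_le_one.trans hw.1
  obtain ⟨hrm, ⟨Cg, hrb⟩, hrg, hrz, -⟩ := Dirichlet.ratio_multiplier hΩ' hφ' hc' hlow
  have hratio : IsPhys (fun U' : GaugeConfig 3 L' SU2 => φ' U' / Ω' U') := ⟨hrm, ⟨Cg, hrb⟩, hrg, hrz⟩
  have havg := Thinning.isPhys_avg_thin_shift (G := SU2) hLL h2 hratio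
  simp only [torusConfigShift_eq_pinnedInline, thin_eq_pinnedInline] at havg
  obtain ⟨Cf, hCf⟩ := havg.bounded
  have hwψ := IsPhys.mul_of_invariant hΩ havg.measurable hCf havg.gaugeInv havg.zeroFlux
  have hΩeig : transferApply β Ω = topValue su2Rep (L' + 1) β • Ω := by
    funext U
    simpa [transferApply] using hE U
  exact UpStep.multiStep_of_oneStep hβ0 hΩ hn hΩeig hwψ (pow_nonneg (topValue_su2Rep_pos L' β').le _) (Real.exp_pos _).le L' hB

end Summit.QuantumFields.YangMills.Cruxes.PinnedUnitStepEx.TISplit1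

end
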